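import Mathlib.Topology.Instances.AddCircle.Defs
import Mathlib.Topology.Piecewise
import Mathlib.Topology.Order.DenselyOrdered
import Mathlib.Analysis.SpecialFunctions.Trigonometric.Basic
import HarnessLib

/-!
# Extending the far lift to a circle homeomorphism lift (piece (K4e) of stub 5a4″
# `stub_carvedReduction_squeezeSolid`)

Piece of stub 5a4″ `stub_carvedReduction_squeezeSolid`
(`TwoPieceAdmRestrictionLimit → MovingCarvingSqueezeP FatAnchoredClassZeroSolid`) of the line
`bridge-gate-renewal` (r11) of the crux `SAWDefectDecoherence.ObservableToSLER`
(stmt-CriticalPhenomena-14005; twin T-A `stub_carvedReduction_squeezeGeometry` of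
stmt-CriticalPhenomena-10472), contract `InnerApproximant`, clause (C2).  The boundary trace
(`…SqueezeInnerTrace`) yields the lift `Θ₀` of the far boundary correspondence, continuous and
strictly increasing on the far parameter intervals `[a + s, b - s]`, `[b + s, a + 1 - s]`, with
`c < Θ₀ (a+s)`, `Θ₀ (b-s) < q < Θ₀ (b+s)`, `Θ₀ (a+1-s) < c + 1`.  This file extends it across the
two near parameter windows to a lift of a circle homeomorphism taking the marks `b`, `a` to the
prescribed angles `q`, `c` (the gate preimages), which is what `stub_carvedReduction_starImage`
consumes:

* `glue_continuousOn_strictMonoOn` — gluing two continuous strictly increasing pieces at a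
  common endpoint value; `tent_strictMono` — the two-slope interpolation
  `t ↦ y + m₁ min (t - x) 0 + m₂ max (t - x) 0`;
* `stub_carvedReduction_liftExtension` — THE LIFT: a continuous strictly increasing
  `Θ : ℝ → ℝ` with `Θ (t + 1) = Θ t + 1`, equal to `Θ₀` on the two far intervals, `Θ b = q`,
  `Θ (a + 1) = c + 1`, and `Θ [b-s, b+s] ⊆ [Θ₀ (b-s), Θ₀ (b+s)]`,
  `Θ [a+1-s, a+1+s] ⊆ [Θ₀ (a+1-s), Θ₀ (a+s) + 1]` (piecewise-linear across the windows, then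
  the periodic extension `t ↦ t + (Θ₁ - id)~` through `AddCircle.liftIco`).

Sources: folklore (lifts of circle homeomorphisms).
-/

noncomputable section
open Set Filter Topology Function

namespace Summit.CriticalPhenomena.SAWScalingLimit.Theorems.ObservableToSLER.Squeeze

/-! ### Gluing and interpolation on the line -/

/-- **Gluing** two continuous strictly increasing pieces `f` on `[u, v]` and `g` on `[v, w]` with
`f v = g v`: the function `if t ≤ v then f t else g t` is continuous and strictly increasing on
`[u, w]`. -/
theorem glue_continuousOn_strictMonoOn {f g : ℝ → ℝ} {u v w : ℝ} (huv : u ≤ v) (hvw : v ≤ w)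
    (hf : ContinuousOn f (Icc u v)) (hg : ContinuousOn g (Icc v w)) (hfm : StrictMonoOn f (Icc u v))
    (hgm : StrictMonoOn g (Icc v w)) (hfg : f v = g v) :
    ContinuousOn (fun t => if t ≤ v then f t else g t) (Icc u w) ∧
      StrictMonoOn (fun t => if t ≤ v then f t else g t) (Icc u w) := by
  constructor
  · refine ContinuousOn.if ?_ ?_ ?_
    · rintro t ⟨-, ht⟩
      rw [show {a : ℝ | a ≤ v} = Iic v from rfl, frontier_Iic] at ht
      rw [mem_singleton_iff.1 ht, hfg]
    · rw [show {a : ℝ | a ≤ v} = Iic v from rfl, closure_Iic]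
      exact hf.mono fun t ht => ⟨ht.1.1, ht.2⟩
    · rw [show {a : ℝ | ¬a ≤ v} = Ioi v by ext t; simp, closure_Ioi]
      exact hg.mono fun t ht => ⟨ht.2, ht.1.2⟩
  · intro x hx y hy hxy
    by_cases hxv : x ≤ v <;> by_cases hyv : y ≤ v <;> simp only [hxv, hyv, if_true, if_false]
    · exact hfm ⟨hx.1, hxv⟩ ⟨hy.1, hyv⟩ hxy
    · push Not at hyv
      calc f x ≤ f v := hfm.monotoneOn ⟨hx.1, hxv⟩ ⟨huv, le_rfl⟩ hxv
        _ = g v := hfg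
        _ < g y := hgm ⟨le_rfl, hvw⟩ ⟨hyv.le, hy.2⟩ hyv
    · push Not at hxv
      exact absurd (hxy.le.trans hyv) (not_le.2 hxv)
    · push Not at hxv hyv
      exact hgm ⟨hxv.le, hx.2⟩ ⟨hyv.le, hy.2⟩ hxy

/-- The two-slope interpolation `t ↦ y + m₁ min (t - x) 0 + m₂ max (t - x) 0` with positive
slopes is continuous and strictly increasing, with value `y` at `x`, `y - m₁ s` at `x - s` and
`y + m₂ s` at `x + s` (`s ≥ 0`). -/
theorem tent_strictMono {x y m₁ m₂ : ℝ} (hm₁ : 0 < m₁) (hm₂ : 0 < m₂) :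
    Continuous (fun t : ℝ => y + m₁ * min (t - x) 0 + m₂ * max (t - x) 0) ∧
      StrictMono (fun t : ℝ => y + m₁ * min (t - x) 0 + m₂ * max (t - x) 0) ∧
      (y + m₁ * min (x - x) 0 + m₂ * max (x - x) 0 = y) ∧
      ∀ s : ℝ, 0 ≤ s → (y + m₁ * min (x - s - x) 0 + m₂ * max (x - s - x) 0 = y - m₁ * s) ∧
        (y + m₁ * min (x + s - x) 0 + m₂ * max (x + s - x) 0 = y + m₂ * s) := by
  refine ⟨by fun_prop, ?_, by simp, fun s hs => ⟨?_, ?_⟩⟩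
  · intro t t' htt
    have h1 : min (t - x) 0 ≤ min (t' - x) 0 := min_le_min_right _ (by linarith)
    have h2 : max (t - x) 0 ≤ max (t' - x) 0 := max_le_max_right _ (by linarith)
    have h3 : min (t - x) 0 + max (t - x) 0 < min (t' - x) 0 + max (t' - x) 0 := by
      rw [min_add_max, min_add_max]; linarith
    rcases h1.lt_or_eq with h1 | h1
    · nlinarith [mul_le_mul_of_nonneg_left h2 hm₂.le]
    · have h2' : max (t - x) 0 < max (t' - x) 0 := by linarith
      nlinarith [mul_lt_mul_of_pos_left h2' hm₂]
  · rw [show x - s - x = -s by ring, min_eq_left (by linarith), max_eq_right (by linarith)]; ring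
  · rw [show x + s - x = s by ring, min_eq_right hs, max_eq_left hs]; ring

/-! ### The periodic extension -/

/-- **Periodic extension of a lift.**  If `Θ₁` is continuous and strictly increasing on
`[a', a' + 1]` with `Θ₁ (a' + 1) = Θ₁ a' + 1`, then there is a continuous strictly increasing
`Θ : ℝ → ℝ` with `Θ (t + 1) = Θ t + 1` agreeing with `Θ₁` on `[a', a' + 1]`. -/
theorem exists_periodic_lift {Θ₁ : ℝ → ℝ} {a' : ℝ} (hc : ContinuousOn Θ₁ (Icc a' (a' + 1)))
    (hm : StrictMonoOn Θ₁ (Icc a' (a' + 1))) (hend : Θ₁ (a' + 1) = Θ₁ a' + 1) :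
    ∃ Θ : ℝ → ℝ, Continuous Θ ∧ StrictMono Θ ∧ (∀ t, Θ (t + 1) = Θ t + 1) ∧
      EqOn Θ Θ₁ (Icc a' (a' + 1)) := by
  set f : ℝ → ℝ := fun u => Θ₁ u - u with hf
  haveI : Fact ((0 : ℝ) < 1) := ⟨one_pos⟩
  set Θ : ℝ → ℝ := fun t => AddCircle.liftIco 1 a' f (t : AddCircle (1 : ℝ)) + t with hΘ
  -- the value formula through the representative in `[a', a' + 1)`
  have hrep : ∀ t : ℝ, Θ t = Θ₁ (toIcoMod one_pos a' t) + (toIcoDiv one_pos a' t : ℝ) := by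
    intro t
    have hcoe : ((toIcoMod one_pos a' t : ℝ) : AddCircle (1 : ℝ)) = (t : AddCircle (1 : ℝ)) := by
      rw [← self_sub_toIcoDiv_zsmul one_pos a' t, QuotientAddGroup.mk_sub, AddCircle.coe_zsmul,
        AddCircle.coe_period, smul_zero, sub_zero]
    simp only [hΘ]
    rw [← hcoe, AddCircle.liftIco_coe_apply (toIcoMod_mem_Ico one_pos a' t)]
    simp only [hf]
    have := toIcoMod_add_toIcoDiv_zsmul one_pos a' t
    rw [zsmul_one] at this
    linarith
  have hper : ∀ t, Θ (t + 1) = Θ t + 1 := by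
    intro t
    simp only [hΘ]
    rw [show ((t + 1 : ℝ) : AddCircle (1 : ℝ)) = (t : AddCircle (1 : ℝ)) from
      AddCircle.coe_add_period 1 t]
    ring
  have hΘeq : EqOn Θ Θ₁ (Icc a' (a' + 1)) := by
    have hIco : ∀ t ∈ Ico a' (a' + 1), Θ t = Θ₁ t := by
      intro t ht
      have hmod : toIcoMod one_pos a' t = t := (toIcoMod_eq_self one_pos).2 ht
      have h1 := toIcoMod_add_toIcoDiv_zsmul one_pos a' t
      rw [hmod, zsmul_one] at h1
      have hdiv : ((toIcoDiv one_pos a' t : ℤ) : ℝ) = 0 := by linarith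
      rw [hrep t, hmod, hdiv, add_zero]
    intro t ht
    rcases ht.2.lt_or_eq with hlt | heq
    · exact hIco t ⟨ht.1, hlt⟩
    · rw [heq, hper, hIco a' ⟨le_rfl, by linarith⟩, hend]
  have hcont : Continuous Θ := by
    have hmk : Continuous (fun t : ℝ => ((t : ℝ) : AddCircle (1 : ℝ))) :=
      continuous_coinduced_rng
    refine Continuous.add ?_ continuous_id
    refine (AddCircle.liftIco_continuous (p := (1 : ℝ)) (a := a') (f := f) ?_ ?_).comp hmk
    · simp only [hf]; rw [hend]; ring
    · exact hc.sub continuousOn_id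
  have hmono : StrictMono Θ := by
    intro x y hxy
    rw [hrep x, hrep y]
    have hdiv : toIcoDiv one_pos a' x ≤ toIcoDiv one_pos a' y := by
      rw [toIcoDiv_eq_floor, toIcoDiv_eq_floor]
      exact Int.floor_le_floor (by simpa using hxy.le)
    have hmx := toIcoMod_mem_Ico one_pos a' x
    have hmy := toIcoMod_mem_Ico one_pos a' y
    rcases hdiv.lt_or_eq with hlt | heq
    · -- one more period: `Θ₁ mx < Θ₁ (a'+1) = Θ₁ a' + 1 ≤ Θ₁ my + 1`
      have h1 : Θ₁ (toIcoMod one_pos a' x) < Θ₁ (a' + 1) :=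
        hm ⟨hmx.1, hmx.2.le⟩ ⟨by linarith, le_rfl⟩ hmx.2
      have h2 : Θ₁ a' ≤ Θ₁ (toIcoMod one_pos a' y) :=
        hm.monotoneOn ⟨le_rfl, by linarith⟩ ⟨hmy.1, hmy.2.le⟩ hmy.1
      have h3 : ((toIcoDiv one_pos a' x : ℤ) : ℝ) + 1 ≤ (toIcoDiv one_pos a' y : ℝ) := by
        exact_mod_cast hlt
      linarith
    · have hxy' : toIcoMod one_pos a' x < toIcoMod one_pos a' y := by
        have hx := toIcoMod_add_toIcoDiv_zsmul one_pos a' x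
        have hy := toIcoMod_add_toIcoDiv_zsmul one_pos a' y
        rw [zsmul_one] at hx hy
        rw [heq] at hx
        linarith
      have := hm ⟨hmx.1, hmx.2.le⟩ ⟨hmy.1, hmy.2.le⟩ hxy'
      rw [heq]; linarith
  exact ⟨Θ, hcont, hmono, hper, hΘeq⟩

/-! ### The lift extension -/

/-- **Registered sub-goal `stub_carvedReduction_liftExtension`** (crux item stmt-CriticalPhenomena-14005,
stub 5a4″ `stub_carvedReduction_squeezeSolid`, piece (K4e) THE LIFT EXTENSION): the far lift
`Θ₀` (continuous, strictly increasing on `[a+s, b-s]` and on `[b+s, a+1-s]`, with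
`c < Θ₀ (a+s)`, `Θ₀ (b-s) < q < Θ₀ (b+s)`, `Θ₀ (a+1-s) < c+1`) extends to a continuous strictly
increasing lift `Θ` of a circle homeomorphism (`Θ (t+1) = Θ t + 1`) with `Θ b = q`,
`Θ (a+1) = c+1`, and the near windows mapped into the near angle windows. -/
theorem stub_carvedReduction_liftExtension :
    ∀ (Θ₀ : ℝ → ℝ) (a b s c q : ℝ), 0 < s → a + s < b - s → b + s < a + 1 - s →
      ContinuousOn Θ₀ (Icc (a + s) (b - s)) → ContinuousOn Θ₀ (Icc (b + s) (a + 1 - s)) →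
      StrictMonoOn Θ₀ (Icc (a + s) (b - s)) → StrictMonoOn Θ₀ (Icc (b + s) (a + 1 - s)) →
      c < Θ₀ (a + s) → Θ₀ (b - s) < q → q < Θ₀ (b + s) → Θ₀ (a + 1 - s) < c + 1 →
      ∃ Θ : ℝ → ℝ, Continuous Θ ∧ StrictMono Θ ∧ (∀ t, Θ (t + 1) = Θ t + 1) ∧
        EqOn Θ Θ₀ (Icc (a + s) (b - s) ∪ Icc (b + s) (a + 1 - s)) ∧ Θ b = q ∧
        Θ (a + 1) = c + 1 ∧
        (∀ t ∈ Icc (b - s) (b + s), Θ t ∈ Icc (Θ₀ (b - s)) (Θ₀ (b + s))) ∧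
        (∀ t ∈ Icc (a + 1 - s) (a + 1 + s), Θ t ∈ Icc (Θ₀ (a + 1 - s)) (Θ₀ (a + s) + 1)) := by
  intro Θ₀ a b s c q hs hab hba hcP hcM hmP hmM hc₁ hq₁ hq₂ hc₂
  -- the two tents across the windows
  obtain ⟨hLbc, hLbm, hLb0, hLbs⟩ := tent_strictMono (x := b) (y := q)
    (m₁ := (q - Θ₀ (b - s)) / s) (m₂ := (Θ₀ (b + s) - q) / s) (div_pos (by linarith) hs)
    (div_pos (by linarith) hs)
  set Lb : ℝ → ℝ := fun t => q + (q - Θ₀ (b - s)) / s * min (t - b) 0 +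
    (Θ₀ (b + s) - q) / s * max (t - b) 0 with hLb
  obtain ⟨hLac, hLam, hLa0, hLas⟩ := tent_strictMono (x := a + 1) (y := c + 1)
    (m₁ := (c + 1 - Θ₀ (a + 1 - s)) / s) (m₂ := (Θ₀ (a + s) - c) / s) (div_pos (by linarith) hs)
    (div_pos (by linarith) hs)
  set La : ℝ → ℝ := fun t => c + 1 + (c + 1 - Θ₀ (a + 1 - s)) / s * min (t - (a + 1)) 0 +
    (Θ₀ (a + s) - c) / s * max (t - (a + 1)) 0 with hLa
  have hLb1 : Lb (b - s) = Θ₀ (b - s) := by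
    have := (hLbs s hs.le).1; simp only [hLb]; rw [this]; field_simp; ring
  have hLb2 : Lb (b + s) = Θ₀ (b + s) := by
    have := (hLbs s hs.le).2; simp only [hLb]; rw [this]; field_simp; ring
  have hLa1 : La (a + 1 - s) = Θ₀ (a + 1 - s) := by
    have := (hLas s hs.le).1; simp only [hLa]; rw [this]; field_simp; ring
  have hLa2 : La (a + 1 + s) = Θ₀ (a + s) + 1 := by
    have := (hLas s hs.le).2; simp only [hLa]; rw [this]; field_simp; ring
  -- glue: `[a+s, b-s] ∪ [b-s, b+s] ∪ [b+s, a+1-s] ∪ [a+1-s, a+1+s]`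
  obtain ⟨h1c, h1m⟩ := glue_continuousOn_strictMonoOn hab.le (by linarith : b - s ≤ b + s) hcP
    hLbc.continuousOn hmP (hLbm.strictMonoOn _) hLb1.symm
  set Θa : ℝ → ℝ := fun t => if t ≤ b - s then Θ₀ t else Lb t with hΘa
  have hΘa2 : Θa (b + s) = Θ₀ (b + s) := by
    simp only [hΘa]; rw [if_neg (by linarith)]; exact hLb2
  obtain ⟨h2c, h2m⟩ := glue_continuousOn_strictMonoOn (by linarith : a + s ≤ b + s) hba.le h1c
    hcM h1m hmM hΘa2
  set Θb : ℝ → ℝ := fun t => if t ≤ b + s then Θa t else Θ₀ t with hΘb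
  have hΘb3 : Θb (a + 1 - s) = La (a + 1 - s) := by
    simp only [hΘb]; rw [if_neg (by linarith)]; exact hLa1.symm
  obtain ⟨h3c, h3m⟩ := glue_continuousOn_strictMonoOn (by linarith : a + s ≤ a + 1 - s)
    (by linarith : a + 1 - s ≤ a + s + 1) h2c (hLac.continuousOn) h2m (hLam.strictMonoOn _) hΘb3
  set Θ₁ : ℝ → ℝ := fun t => if t ≤ a + 1 - s then Θb t else La t with hΘ₁
  -- values of `Θ₁`
  have hΘ₁far : EqOn Θ₁ Θ₀ (Icc (a + s) (b - s) ∪ Icc (b + s) (a + 1 - s)) := by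
    intro t ht
    rcases ht with ht | ht
    · simp only [hΘ₁, hΘb, hΘa]
      rw [if_pos (by linarith [ht.2]), if_pos (by linarith [ht.2]), if_pos ht.2]
    · simp only [hΘ₁, hΘb]
      rw [if_pos ht.2]
      rcases ht.1.eq_or_lt with h | h
      · rw [if_pos h.symm.le, ← h]; exact hΘa2
      · rw [if_neg (not_le.2 h)]
  have hΘ₁b : ∀ t ∈ Icc (b - s) (b + s), Θ₁ t = Lb t := by
    intro t ht
    simp only [hΘ₁, hΘb, hΘa]
    rw [if_pos (by linarith [ht.2]), if_pos ht.2]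
    rcases ht.1.eq_or_lt with h | h
    · rw [if_pos h.symm.le, ← h, hLb1]
    · rw [if_neg (not_le.2 h)]
  have hΘ₁a : ∀ t ∈ Icc (a + 1 - s) (a + 1 + s), Θ₁ t = La t := by
    intro t ht
    simp only [hΘ₁]
    rcases ht.1.eq_or_lt with h | h
    · rw [if_pos h.symm.le, ← h]; exact hΘb3
    · rw [if_neg (not_le.2 h)]
  have hend : Θ₁ (a + s + 1) = Θ₁ (a + s) + 1 := by
    rw [hΘ₁far (Or.inl (left_mem_Icc.2 hab.le)), show a + s + 1 = a + 1 + s by ring,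
      hΘ₁a _ ⟨by linarith, le_rfl⟩, hLa2]
  obtain ⟨Θ, hΘc, hΘm, hΘper, hΘeq⟩ := exists_periodic_lift h3c h3m hend
  have hwin : Icc (a + s) (a + s + 1) = Icc (a + s) (a + s + 1) := rfl
  refine ⟨Θ, hΘc, hΘm, hΘper, fun t ht => ?_, ?_, ?_, fun t ht => ?_, fun t ht => ?_⟩
  · rw [hΘeq (by rcases ht with ht | ht <;> exact ⟨by linarith [ht.1], by linarith [ht.2]⟩)]
    exact hΘ₁far ht
  · rw [hΘeq ⟨by linarith, by linarith⟩, hΘ₁b b ⟨by linarith, by linarith⟩]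
    simp only [hLb]; exact hLb0
  · rw [hΘeq ⟨by linarith, by linarith⟩, hΘ₁a (a + 1) ⟨by linarith, by linarith⟩]
    simp only [hLa]; exact hLa0
  · rw [hΘeq ⟨by linarith [ht.1], by linarith [ht.2]⟩, hΘ₁b t ht, ← hLb1, ← hLb2]
    exact ⟨hLbm.monotone ht.1, hLbm.monotone ht.2⟩
  · rw [hΘeq ⟨by linarith [ht.1], by linarith [ht.2]⟩, hΘ₁a t ht, ← hLa1, ← hLa2]
    exact ⟨hLam.monotone ht.1, hLam.monotone ht.2⟩

end Summit.CriticalPhenomena.SAWScalingLimit.Theorems.ObservableToSLER.Squeeze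

end
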